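import Summits.AnomalousDissipation.AnomalousDissipation.Theorems.SolenoidalFractalHomogenisationLagrangianStepVmodCorrectedGeneratorFrame
import Summits.AnomalousDissipation.AnomalousDissipation.Theorems.SolenoidalFractalHomogenisationLagrangianStepVmodLossAdjDuality
import Literature.Analysis.FluidPDE.PassiveVectorVarTensorGarding
import HarnessLib

/-!
# K1L_D (stmt-AnomalousDissipation-27980), (ℓ3-A) road A, (S2-adj) glue: the `L²` SIZE `M` of the onset field `g_σ = 𝓛^{𝔸^G,*}(J•φ₀) + 𝓛^{(𝔸ᵀ)^G,*}(J•φ₀)`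
# (the `hgM` input of `EnergyDuhamelG.lossAdj_ge_onsetWindow`, sup-norm version)
(helper; `--supports 27980 --as helper`; prover ad-k1loc-p3 g12; same technology as (S1b)/(S1c)/(S1d) p727116/p727473/p727884 — pointwise majorant in the
layers `‖φ₀‖, Σ‖∂φ₀‖, ΣΣ‖∂²φ₀‖`, then `memLp_and_eLpNorm_le_of_pointwise`.)

CONVENTION (D28-8′): derivative-index distortion `Torus.Visc4.conj`; constraint `∇·(G v) = 0`.

* `norm_onsetG_le_pt` — pointwise: `‖𝓛^{𝔹₀^{Gs},*}(J•ζ)(x) + 𝓛^{(𝔹₀ᵀ)^{Gs},*}(J•ζ)(x)‖ ≤ testMajorant ζ a₀ a₁ a₂ x` with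
  `a₀ = 6(27·CA₀C·81C₂ + 81(CA₀B+BA₀C)·27C₁)`, `a₁ = 6(27·CA₀C·54C₁ + 81(CA₀B+BA₀C)·9C₀)`, `a₂ = 6·27·CA₀C·9C₀`
  (`|Gs| ≤ C`, `|∂Gs| ≤ B`, `|𝔹₀| ≤ A₀`, `|J| ≤ C₀`, `|∂J| ≤ C₁`, `|∂²J| ≤ C₂`; `norm_viscAdjVar_le_pt` twice + `sum_norm_partialDeriv(₂)_distort_le_pt`);
* `memLp_and_eLpNorm_onsetG_le` — `MemLp` and the `L²` bound in the three layer norms of `ζ`;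
* **`IsFrameRegular.eLpNorm_onsetG_le`** — along `IsFrameModulation θ Tw nC G` / `IsFrameRegular θ Tw nC G J` (`θ ≤ 1/18`) at a window time:
  `C = 1+θ`, `B = θnC`, `C₀ = 2`, `C₁ = 2θnC`, `C₂ = 2θnC²` — this is the sup-norm `M` of FINDING F-p3g12-1 (`~ hi·θnC²`, lossy for low slow modes).
`sorry`-free; NOT a proof of any block, of K1L_D or of AD; rung F-D1.A0.
-/

set_option linter.dupNamespace false

noncomputable section

namespace Summit.AnomalousDissipation.AnomalousDissipation.Theorems.SolenoidalFractalHomogenisation.LagrangianStep.VmodDist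

open Literature.Analysis Literature.Analysis.FluidPDE Literature.Analysis.FunctionSpaces
open MeasureTheory Set Filter Function
open scoped ENNReal NNReal InnerProductSpace
open Summit.AnomalousDissipation.AnomalousDissipation.Theorems.SolenoidalFractalHomogenisation.LagrangianStep.CellClauseMod

variable {Gs Jt : UnitAddTorus (Fin 3) → Matrix (Fin 3) (Fin 3) ℝ} {ζ : VF}

/-- **Pointwise majorant of the onset field.** -/
theorem norm_onsetG_le_pt (hG1 : ∀ i j, Torus.IsContDiff 1 (fun y => Gs y i j)) (hJ : ∀ a m, Torus.IsSmooth (fun y => Jt y a m))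
    (hζ : Torus.IsSmooth ζ) (𝔹₀ : Torus.Visc4 (Fin 3)) {C B A₀ C₀ C₁ C₂ : ℝ} (hC0 : 0 ≤ C) (hB0 : 0 ≤ B) (hA0 : 0 ≤ A₀)
    (hc0 : 0 ≤ C₀) (hc1 : 0 ≤ C₁) (hc2 : 0 ≤ C₂)
    (hC : ∀ y i j, |Gs y i j| ≤ C) (hB : ∀ y i j e', |Torus.partialDeriv e' (fun y => Gs y i j) y| ≤ B) (hA : ∀ i a j b', |𝔹₀ i a j b'| ≤ A₀)
    (hJ0 : ∀ y a m, |Jt y a m| ≤ C₀) (hJ1 : ∀ y a m c, |Torus.partialDeriv c (fun y => Jt y a m) y| ≤ C₁)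
    (hJ2 : ∀ y a m c e, |Torus.partialDeriv e (Torus.partialDeriv c (fun y => Jt y a m)) y| ≤ C₂) (x : UnitAddTorus (Fin 3)) :
    ‖Torus.viscAdjVar (fun y => Torus.Visc4.conj (Gs y) 𝔹₀) (Torus.distort Jt ζ) x
        + Torus.viscAdjVar (fun y => Torus.Visc4.conj (Gs y) (Torus.majorTranspose 𝔹₀)) (Torus.distort Jt ζ) x‖
      ≤ testMajorant ζ (6 * (27 * (C * A₀ * C) * (81 * C₂) + 81 * (C * A₀ * B + B * A₀ * C) * (27 * C₁)))
          (6 * (27 * (C * A₀ * C) * (54 * C₁) + 81 * (C * A₀ * B + B * A₀ * C) * (9 * C₀)))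
          (6 * (27 * (C * A₀ * C) * (9 * C₀))) x := by
  have hΨ : Torus.IsSmooth (Torus.distort Jt ζ) := Torus.isSmooth_distort hJ hζ
  have hAt : ∀ i a j b', |Torus.majorTranspose 𝔹₀ i a j b'| ≤ A₀ := fun i a j b' => by
    rw [Torus.majorTranspose_apply]; exact hA j b' i a
  have h1 := norm_viscAdjVar_le_pt hG1 hΨ 𝔹₀ hC0 hB0 hA0 hC hB hA x
  have h2 := norm_viscAdjVar_le_pt hG1 hΨ (Torus.majorTranspose 𝔹₀) hC0 hB0 hA0 hC hB hAt x
  have hS1 := sum_norm_partialDeriv_distort_le_pt (ζ := ζ) hJ hζ hc0 hc1 hJ0 hJ1 x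
  have hS2 := sum_norm_partialDeriv₂_distort_le_pt (ζ := ζ) hJ hζ hc0 hc1 hc2 hJ0 hJ1 hJ2 x
  have hK1 : 0 ≤ 27 * (C * A₀ * C) := by positivity
  have hK2 : 0 ≤ 81 * (C * A₀ * B + B * A₀ * C) := by positivity
  have hn0 : 0 ≤ ‖ζ x‖ := norm_nonneg _
  have hn1 : 0 ≤ ∑ c, ‖Torus.partialDeriv c ζ x‖ := Finset.sum_nonneg fun _ _ => norm_nonneg _
  have hn2 : 0 ≤ ∑ c, ∑ e, ‖Torus.partialDeriv e (Torus.partialDeriv c ζ) x‖ :=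
    Finset.sum_nonneg fun _ _ => Finset.sum_nonneg fun _ _ => norm_nonneg _
  rw [testMajorant_apply]
  refine (norm_add_le _ _).trans ?_
  have hsum := add_le_add h1 h2
  refine hsum.trans ?_
  have e1 := mul_le_mul_of_nonneg_left hS2 hK1
  have e2 := mul_le_mul_of_nonneg_left hS1 hK2
  nlinarith [e1, e2, hn0, hn1, hn2, hK1, hK2, hc0, hc1, hc2]

/-- **`L²` size of the onset field** in the layer norms of `ζ` (`MemLp` and the `eLpNorm` bound). -/
theorem memLp_and_eLpNorm_onsetG_le (hGs : ∀ i j, Torus.IsSmooth (fun y => Gs y i j)) (hJ : ∀ a m, Torus.IsSmooth (fun y => Jt y a m))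
    (hζ : Torus.IsSmooth ζ) (𝔹₀ : Torus.Visc4 (Fin 3)) {C B A₀ C₀ C₁ C₂ : ℝ} (hC0 : 0 ≤ C) (hB0 : 0 ≤ B) (hA0 : 0 ≤ A₀)
    (hc0 : 0 ≤ C₀) (hc1 : 0 ≤ C₁) (hc2 : 0 ≤ C₂)
    (hC : ∀ y i j, |Gs y i j| ≤ C) (hB : ∀ y i j e', |Torus.partialDeriv e' (fun y => Gs y i j) y| ≤ B) (hA : ∀ i a j b', |𝔹₀ i a j b'| ≤ A₀)
    (hJ0 : ∀ y a m, |Jt y a m| ≤ C₀) (hJ1 : ∀ y a m c, |Torus.partialDeriv c (fun y => Jt y a m) y| ≤ C₁)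
    (hJ2 : ∀ y a m c e, |Torus.partialDeriv e (Torus.partialDeriv c (fun y => Jt y a m)) y| ≤ C₂) :
    MemLp (fun x => Torus.viscAdjVar (fun y => Torus.Visc4.conj (Gs y) 𝔹₀) (Torus.distort Jt ζ) x
        + Torus.viscAdjVar (fun y => Torus.Visc4.conj (Gs y) (Torus.majorTranspose 𝔹₀)) (Torus.distort Jt ζ) x) 2 volume ∧
    eLpNorm (fun x => Torus.viscAdjVar (fun y => Torus.Visc4.conj (Gs y) 𝔹₀) (Torus.distort Jt ζ) x
        + Torus.viscAdjVar (fun y => Torus.Visc4.conj (Gs y) (Torus.majorTranspose 𝔹₀)) (Torus.distort Jt ζ) x) 2 volume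
      ≤ ENNReal.ofReal
        ((6 * (27 * (C * A₀ * C) * (81 * C₂) + 81 * (C * A₀ * B + B * A₀ * C) * (27 * C₁))) * (eLpNorm ζ 2 volume).toReal
        + (6 * (27 * (C * A₀ * C) * (54 * C₁) + 81 * (C * A₀ * B + B * A₀ * C) * (9 * C₀))) * ∑ c, (eLpNorm (Torus.partialDeriv c ζ) 2 volume).toReal
        + (6 * (27 * (C * A₀ * C) * (9 * C₀))) * ∑ c, ∑ e, (eLpNorm (Torus.partialDeriv e (Torus.partialDeriv c ζ)) 2 volume).toReal) := by
  have hΨ : Torus.IsSmooth (Torus.distort Jt ζ) := Torus.isSmooth_distort hJ hζ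
  have h𝔹₁ : ∀ i c l e, Torus.IsSmooth (fun y => Torus.Visc4.conj (Gs y) 𝔹₀ i c l e) := fun i c l e => isSmooth_conj_field hGs 𝔹₀ i c l e
  have h𝔹₂ : ∀ i c l e, Torus.IsSmooth (fun y => Torus.Visc4.conj (Gs y) (Torus.majorTranspose 𝔹₀) i c l e) :=
    fun i c l e => isSmooth_conj_field hGs _ i c l e
  have hsm : Torus.IsSmooth (fun x => Torus.viscAdjVar (fun y => Torus.Visc4.conj (Gs y) 𝔹₀) (Torus.distort Jt ζ) x
      + Torus.viscAdjVar (fun y => Torus.Visc4.conj (Gs y) (Torus.majorTranspose 𝔹₀)) (Torus.distort Jt ζ) x) :=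
    (Torus.isSmooth_viscAdjVar h𝔹₁ hΨ).add (Torus.isSmooth_viscAdjVar h𝔹₂ hΨ)
  have hF := hsm.continuous.aestronglyMeasurable (μ := (volume : Measure (UnitAddTorus (Fin 3))))
  have hG1 : ∀ i j, Torus.IsContDiff 1 (fun y => Gs y i j) := fun i j => (hGs i j).isContDiff (by simp)
  refine memLp_and_eLpNorm_le_of_pointwise hF hζ (by positivity) (by positivity) (by positivity) fun x => ?_
  exact norm_onsetG_le_pt hG1 hJ hζ 𝔹₀ hC0 hB0 hA0 hc0 hc1 hc2 hC hB hA hJ0 hJ1 hJ2 x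

variable {θ Tw nC : ℝ} {G J : ℝ → UnitAddTorus (Fin 3) → Matrix (Fin 3) (Fin 3) ℝ}

/-- **The sup-norm `M` of the onset window along the frame class** (`θ ≤ 1/18`): at every window time `t ∈ [0,Tw]`, for a tensor `𝔸'` with `|𝔸'| ≤ A`
and a smooth `ζ`, `‖𝓛^{𝔸'^{G t},*}(J t•ζ) + 𝓛^{(𝔸'ᵀ)^{G t},*}(J t•ζ)‖_{L²} ≤ a₀‖ζ‖₂ + a₁Σ‖∂ζ‖₂ + a₂ΣΣ‖∂²ζ‖₂` with the constants of `norm_onsetG_le_pt` at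
`C = 1+θ`, `B = θnC`, `A₀ = A`, `C₀ = 2`, `C₁ = 2θnC`, `C₂ = 2θnC²`. -/
theorem IsFrameRegular.eLpNorm_onsetG_le (hR : IsFrameRegular θ Tw nC G J) (hG : IsFrameModulation θ Tw nC G) (hθ : θ ≤ 1 / 18) (hnC : 0 ≤ nC)
    {t : ℝ} (ht : t ∈ Icc 0 Tw) (𝔸' : Torus.Visc4 (Fin 3)) {A : ℝ} (hA0 : 0 ≤ A) (hA : ∀ i a j b', |𝔸' i a j b'| ≤ A) (hζ : Torus.IsSmooth ζ) :
    (eLpNorm (fun x => Torus.viscAdjVar (fun y => Torus.Visc4.conj (G t y) 𝔸') (Torus.distort (J t) ζ) x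
        + Torus.viscAdjVar (fun y => Torus.Visc4.conj (G t y) (Torus.majorTranspose 𝔸')) (Torus.distort (J t) ζ) x) 2 volume).toReal
      ≤ (6 * (27 * ((1 + θ) * A * (1 + θ)) * (81 * (2 * θ * nC ^ 2)) + 81 * ((1 + θ) * A * (θ * nC) + (θ * nC) * A * (1 + θ)) * (27 * (2 * θ * nC))))
          * (eLpNorm ζ 2 volume).toReal
        + (6 * (27 * ((1 + θ) * A * (1 + θ)) * (54 * (2 * θ * nC)) + 81 * ((1 + θ) * A * (θ * nC) + (θ * nC) * A * (1 + θ)) * (9 * 2)))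
          * ∑ c, (eLpNorm (Torus.partialDeriv c ζ) 2 volume).toReal
        + (6 * (27 * ((1 + θ) * A * (1 + θ)) * (9 * 2))) * ∑ c, ∑ e, (eLpNorm (Torus.partialDeriv e (Torus.partialDeriv c ζ)) 2 volume).toReal := by
  have hTw : 0 ≤ Tw := ht.1.trans ht.2
  have hθ0 : 0 ≤ θ := theta_nonneg_of_isFrameModulation hG hTw
  have key := memLp_and_eLpNorm_onsetG_le (Gs := G t) (Jt := J t) (fun i j => hG.smooth t ht i j) (hR.smooth t) hζ 𝔸'
    (C := 1 + θ) (B := θ * nC) (A₀ := A) (C₀ := 2) (C₁ := 2 * θ * nC) (C₂ := 2 * θ * nC ^ 2)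
    (by linarith) (by positivity) hA0 (by norm_num) (by positivity) (by positivity)
    (fun y i j => abs_frame_entry_le hG ht y i j) (fun y i j e' => hG.grad_le t ht y i j e') hA
    (fun y a m => hR.abs_inverse_entry_le_two hG hθ ht y a m) (fun y a m c => hR.abs_partialDeriv_inv_le ht y a m c)
    (fun y a m c e => hR.abs_partialDeriv₂_inv_le ht y a m c e)
  obtain ⟨_, hle⟩ := key
  have h1 : 0 ≤ (eLpNorm ζ 2 volume).toReal := ENNReal.toReal_nonneg
  have h2 : 0 ≤ ∑ c, (eLpNorm (Torus.partialDeriv c ζ) 2 volume).toReal := Finset.sum_nonneg fun _ _ => ENNReal.toReal_nonneg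
  have h3 : 0 ≤ ∑ c, ∑ e, (eLpNorm (Torus.partialDeriv e (Torus.partialDeriv c ζ)) 2 volume).toReal :=
    Finset.sum_nonneg fun _ _ => Finset.sum_nonneg fun _ _ => ENNReal.toReal_nonneg
  have h4 : 0 ≤ 1 + θ := by linarith
  have hA2 : 0 ≤ (1 + θ) * A * (1 + θ) := by positivity
  have hmix : 0 ≤ (1 + θ) * A * (θ * nC) + θ * nC * A * (1 + θ) := by positivity
  have hnn : 0 ≤ (6 * (27 * ((1 + θ) * A * (1 + θ)) * (81 * (2 * θ * nC ^ 2)) + 81 * ((1 + θ) * A * (θ * nC) + (θ * nC) * A * (1 + θ)) * (27 * (2 * θ * nC))))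
          * (eLpNorm ζ 2 volume).toReal
        + (6 * (27 * ((1 + θ) * A * (1 + θ)) * (54 * (2 * θ * nC)) + 81 * ((1 + θ) * A * (θ * nC) + (θ * nC) * A * (1 + θ)) * (9 * 2)))
          * ∑ c, (eLpNorm (Torus.partialDeriv c ζ) 2 volume).toReal
        + (6 * (27 * ((1 + θ) * A * (1 + θ)) * (9 * 2))) * ∑ c, ∑ e, (eLpNorm (Torus.partialDeriv e (Torus.partialDeriv c ζ)) 2 volume).toReal := by
    have hθn : 0 ≤ θ * nC := mul_nonneg hθ0 hnC
    refine add_nonneg (add_nonneg (mul_nonneg ?_ h1) (mul_nonneg ?_ h2)) (mul_nonneg ?_ h3)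
    · nlinarith [hA2, hmix, hθn, hθ0, hnC, mul_nonneg hθ0 (sq_nonneg nC)]
    · nlinarith [hA2, hmix, hθn]
    · nlinarith [hA2]
  exact ENNReal.toReal_le_of_le_ofReal hnn hle

end Summit.AnomalousDissipation.AnomalousDissipation.Theorems.SolenoidalFractalHomogenisation.LagrangianStep.VmodDist

end
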